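import Literature.AlgebraicGeometry.Resolution.PointBlowupFlagShiftBound
import HarnessLib

/-!
# Hauser–Perlega, Proposition 3 (the `s`-component): along the flags `F₁ = V(z₁, y + h(x))` the numeral `s_𝓕`
# attains a finite maximum off the terminal cases

H. Hauser, S. Perlega, *Resolving surface singularities in positive characteristic*, Publ. RIMS Kyoto Univ. **60**
(2024) 767–813 [cite: HauserPerlega2024], **Proposition 3** (p. 791 l. 71 – p. 792 l. 44): "There exists a maximizing
flag `𝓕 ∈ F` with `inv^𝓕_a(X) ∈ ℕ³` and `d_𝓕 > 0`."  This file transcribes the part of the printed proof that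
consumes Lemma 3 (the tree's `PointBlowupFlagShiftBound`), namely the case-(i) flags (`n_𝓕 = 0`) with `d_res ≥ pᵉ`:
"assume … no maximizing flag … a sequence of flags `𝓕^i ∈ F` … `inv = (d_res, 0, s_{𝓕^i})` … `s_{𝓕^i} ≥ i` …
`F₁^i = V(z + g_i(x,y), y + h_i(x))` … by Lemma 3 that `ord(h_{i+1} − h_i) = s_{𝓕^i}/d!`. Hence,
`y_∞ = y + Σ_{i≥0} (h_{i+1} − h_i)` is a well-defined power series … the flag `𝓕 ∈ F` defined by `F₂ = V(z + g(x,y))`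
and `F₁ = V(z + g(x,y), y_∞)` … `s_𝓕 = ∞` … `coeff_{d_res}(G₁) = 0` … `G₁ = y₁^{d_res}·u` for some unit `u` … `X` is
in the monomial case at `a`. This contradicts our assumption that `X` is not in a terminal case at `a`."

## What is proved (sorry-free; any field `K` of characteristic `p`; NO new definition, NO named fact)

* Section A — ROWS (families `ℕ → K[[x]]` bound by coefficient identities, as in Section A of
  `PointBlowupFlagShiftBound`): the order bound `ord ≥ d` and the existence of a clean term of degree `d` survive a
  triangular shift followed by cleaning (`shift_rows_degree_ge`, `exists_clean_degree_term_of_shift`: the top row of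
  the degree-`d` layer is fixed by the unipotent shear); rows agree below the order of the shift
  (`coeff_cleanShift_rows_eq_of_lt`); `s = ∞` kills the rows `i < d` (`rows_eq_zero_of_inf_eq_top`); `d!·N ≤ s` kills
  them below degree `N` (`coeff_rows_eq_zero_of_le_inf`).
* Section B — TWO LETTERS: the triangular substitution `y ↦ y + φ(x)` (`hasSubst_shift`), the support of the
  expansion (`exists_coeff_ne_zero_of_coeff_subst_shift`), the shift by `0`, and the COMPOSITION of two shifts
  (`subst_shift_subst_shift`) — the re-basing "`y_i := y + h_i`".
* Section C — SERIES LEVEL, for a germ `H ∈ K[[x, y]]` with `x^r ∣ H` (covers the polynomial states of the atlas AND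
  the power-series germs of the surface games; the rows of `clean_q(H(x, y + φ(x)))/x^r` are bound by coefficient
  identities and `s⟨φ⟩ = min_{i<d} (d!/(d−i))·ord(row i)` is a `Finset.inf`, no definition): RE-BASING
  (`coeff_cleanShift_rebase`, via `cleanSeries_subst_cleanSeries` of `PointBlowupFlagShiftBound` §E); cleanness, the
  order bound and a clean degree-`d` term for every shift (`cleanShift_rows_clean`, `cleanShift_rows_degree_ge`,
  `cleanShift_rows_exists_degree_eq` — "`ord G₁ = d_res`"); **Lemma 3 between ANY two shifts**
  (`factorial_mul_order_sub_eq_inf_rows_of_lt`); agreement below `ord(φ₂ − φ₁)`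
  (`coeff_cleanShift_rows_eq_of_le_order`); **the limit flag `y_∞`** (`exists_inf_rows_eq_top_or_bounded`: some
  `s⟨φ⟩ = ∞` or `s` is bounded); **`s = ∞` is a hidden monomial** `x^r·y^d·u` (`exists_eq_monomial_mul_of_inf_rows_eq_top`);
  and **Proposition 3's `s`-component** (`exists_isGreatest_inf_rows_or_monomial`: a hidden monomial along some shift,
  or a shift with GREATEST, FINITE `s`).
* Section D — TYPED LAYER (`PointBlowupFlagInvariant`: two letters, `F ≠ 0` clean, `E = ∅ ∨ E = {x}`, `d_res ≥ pᵉ`):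
  the states satisfy the series-level hypotheses (`exists_excExponent_eq_single`, `coeff_row_residualFlat`); **Lemma 3
  for a general pair of case-(i) flags** (`factorial_mul_order_sub_eq_sValue_of_lt`:
  `s⟨y,x,h₁⟩ < s⟨y,x,h₂⟩ ⇒ d_res!·ord(h₂ − h₁) = s⟨y,x,h₁⟩`, the re-based form left open in `PointBlowupFlagShiftBound`);
  `s_𝓕 = ∞ ⇒ IsTerminalSub` (`isTerminalSub_of_sValue_eq_top`); and **Proposition 3, `s`-component**
  (`exists_isGreatest_sValue`): off the terminal cases the case-(i) flags `⟨y, x, h⟩` have one with greatest, finite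
  `sValue`.

## What is NOT proved here

The assembly of Proposition 3 for the full flag invariant `(d, n, s)` (tangent flags, the companion branch
`0 < d_res < pᵉ`, the swapped orientation, `IsGreatest (flagValues …)`); Proposition 4.

Provenance: seat res-D-pv-058 acting as res-L1-w43-stub-6 (cell res-hironaka, chain W4.3), 2026-08-27; a Literature
transcription of a PRINTED, refereed proposition in the tree's polynomial/power-series model — not a statement about
any manuscript under adjudication.
-/

noncomputable section

open MvPolynomial Finset
open scoped BigOperators

namespace Literature.AlgebraicGeometry.Resolution

open Literature.AlgebraicGeometry.Resolution.Hauser2010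
open Literature.AlgebraicGeometry.Resolution.PointBlowup
open Literature.AlgebraicGeometry.Resolution.HauserWagner2014

namespace HauserPerlega2024

/-! ## A. Rows: what survives a shift followed by a cleaning -/

section Rows

variable {K : Type*} [Field K]

/-- a row vanishing below degree `m` has order `≥ m`. [folklore] -/
private theorem natCast_le_order_of_coeff_eq_zero {G : PowerSeries K} {m : ℕ}
    (h : ∀ a, a < m → PowerSeries.coeff a G = 0) : (m : ℕ∞) ≤ G.order :=
  PowerSeries.nat_le_order G m fun a ha => h a ha

/-- Below `k·ord φ + ord G` the product `φ^k·G` has no coefficients (`ℕ`-form with a lower bound on `ord G` given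
through vanishing coefficients). [folklore] -/
private theorem coeff_pow_mul_eq_zero_of_lt' {φ G : PowerSeries K} {k a n m : ℕ}
    (hφ : (n : ℕ∞) ≤ φ.order) (hG : ∀ b, b < m → PowerSeries.coeff b G = 0) (h : a < k * n + m) :
    PowerSeries.coeff a (φ ^ k * G) = 0 := by
  apply PowerSeries.coeff_of_lt_order
  have h1 : ((k * n + m : ℕ) : ℕ∞) ≤ (φ ^ k * G).order := by
    calc ((k * n + m : ℕ) : ℕ∞) = k • (n : ℕ∞) + (m : ℕ∞) := by push_cast; rw [nsmul_eq_mul]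
      _ ≤ k • φ.order + G.order := add_le_add (nsmul_le_nsmul_right hφ k) (natCast_le_order_of_coeff_eq_zero hG)
      _ ≤ (φ ^ k).order + G.order := add_le_add (PowerSeries.le_order_pow φ k) le_rfl
      _ ≤ (φ ^ k * G).order := PowerSeries.le_order_mul _ _
  exact lt_of_lt_of_le (by exact_mod_cast h) h1

/-- **The order bound `ord ≥ d` survives the shift**: if every row `G_j` vanishes below degree `d − j` (all terms of
`G = Σ G_j yʲ` have degree `≥ d`) and `φ(0) = 0`, the shifted rows "`G̃_i = Σ_{j≥i} binom(j,i) φ^{j−i} G_j`" vanish below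
degree `d − i` as well. [cite: HauserPerlega2024, Lemma 3 proof p. 791 l. 20–28 (the shifted rows)] -/
theorem shift_rows_degree_ge {d : ℕ} (G Gs : ℕ → PowerSeries K) (φ : PowerSeries K)
    (hφ0 : PowerSeries.constantCoeff φ = 0)
    (hGs : ∀ i a, PowerSeries.coeff a (Gs i) =
      ∑ k ∈ Finset.range (a + 1),
        (((i + k).choose i : ℕ) : K) * PowerSeries.coeff a (φ ^ k * G (i + k)))
    (hmin : ∀ i a, PowerSeries.coeff a (G i) ≠ 0 → d ≤ i + a) :
    ∀ i a, PowerSeries.coeff a (Gs i) ≠ 0 → d ≤ i + a := by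
  intro i a hne
  by_contra hlt
  push Not at hlt
  apply hne
  rw [hGs]
  refine Finset.sum_eq_zero fun k _ => ?_
  have h1 : (1 : ℕ∞) ≤ φ.order := by
    have h2 : φ.order ≠ 0 := PowerSeries.order_ne_zero_iff_constCoeff_eq_zero.mpr hφ0
    exact Order.one_le_iff_ne_zero.mpr h2
  rw [coeff_pow_mul_eq_zero_of_lt' (n := 1) (m := d - (i + k)) (by exact_mod_cast h1) _ (by omega), mul_zero]
  intro b hb
  by_contra hb'
  have := hmin (i + k) b hb'
  omega

/-- **A clean term of degree `d` survives the shift and the cleaning**: with `G` as above having a term of degree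
exactly `d` and clean (no coefficient `[x^a yⁱ]` with `q ∣ r + a` and `q ∣ i`), take the LARGEST `j ≤ d` with
`[x^{d−j}]G_j ≠ 0`; in the shifted row `j` the coefficient of `x^{d−j}` is unchanged (the shear is unipotent on the
degree-`d` layer), and it is not deleted by the cleaning.  Hence the cleaned shifted rows `Gc` again have a clean term
of degree `d` (so "`ord G₁ = d_res`", p. 791 l. 12; p. 792 l. 36–38). [cite: HauserPerlega2024, Lemma 3 proof p. 791 l. 10–12, l. 30–32] -/
theorem exists_clean_degree_term_of_shift {q d r : ℕ} (G Gs Gc : ℕ → PowerSeries K) (φ : PowerSeries K)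
    (hφ0 : PowerSeries.constantCoeff φ = 0)
    (hGs : ∀ i a, PowerSeries.coeff a (Gs i) =
      ∑ k ∈ Finset.range (a + 1),
        (((i + k).choose i : ℕ) : K) * PowerSeries.coeff a (φ ^ k * G (i + k)))
    (hGc : ∀ i a, PowerSeries.coeff a (Gc i) =
      if q ∣ r + a ∧ q ∣ i then 0 else PowerSeries.coeff a (Gs i))
    (hclean : ∀ i a, PowerSeries.coeff a (G i) ≠ 0 → ¬ (q ∣ r + a ∧ q ∣ i))
    (hmin : ∀ i a, PowerSeries.coeff a (G i) ≠ 0 → d ≤ i + a)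
    (hex : ∃ i a, PowerSeries.coeff a (G i) ≠ 0 ∧ i + a = d) :
    ∃ i a, PowerSeries.coeff a (Gc i) ≠ 0 ∧ i + a = d := by
  classical
  -- the largest row index `j ≤ d` carrying a degree-`d` coefficient
  obtain ⟨i₁, a₁, h₁, hia₁⟩ := hex
  set S : Finset ℕ := (Finset.range (d + 1)).filter fun j => PowerSeries.coeff (d - j) (G j) ≠ 0 with hS
  have hi₁S : i₁ ∈ S := by
    rw [hS, Finset.mem_filter, Finset.mem_range]
    exact ⟨by omega, by rw [show d - i₁ = a₁ by omega]; exact h₁⟩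
  have hSne : S.Nonempty := ⟨i₁, hi₁S⟩
  set j := S.max' hSne with hj
  have hjS : j ∈ S := Finset.max'_mem S hSne
  rw [hS, Finset.mem_filter, Finset.mem_range] at hjS
  obtain ⟨hjd, hGj⟩ := hjS
  have hmax : ∀ j', j' ≤ d → PowerSeries.coeff (d - j') (G j') ≠ 0 → j' ≤ j := by
    intro j' hj'd hne
    apply Finset.le_max' S j'
    rw [hS, Finset.mem_filter, Finset.mem_range]
    exact ⟨by omega, hne⟩
  -- the shifted row `j` keeps the coefficient of `x^{d−j}`
  have h1 : (1 : ℕ∞) ≤ φ.order := by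
    have h2 : φ.order ≠ 0 := PowerSeries.order_ne_zero_iff_constCoeff_eq_zero.mpr hφ0
    exact Order.one_le_iff_ne_zero.mpr h2
  have hcoef : PowerSeries.coeff (d - j) (Gs j) = PowerSeries.coeff (d - j) (G j) := by
    rw [hGs, Finset.sum_eq_single 0]
    · simp
    · intro k _ hk0
      rw [coeff_pow_mul_eq_zero_of_lt' (n := 1) (m := d + 1 - (j + k)) (by exact_mod_cast h1) _ (by omega),
        mul_zero]
      intro b hb
      by_contra hb'
      have hge := hmin (j + k) b hb'
      -- `b = d − j − k` exactly, contradicting the maximality of `j`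
      have hjk : j + k ≤ d := by omega
      have hb2 : b = d - (j + k) := by omega
      have := hmax (j + k) hjk (by rw [← hb2]; exact hb')
      omega
    · intro h; exact absurd (Finset.mem_range.mpr (Nat.succ_pos _)) h
  refine ⟨j, d - j, ?_, by omega⟩
  rw [hGc, if_neg (hclean j (d - j) hGj), hcoef]
  exact hGj

/-- **Rows agree below the order of the shift**: if `ord φ ≥ N`, the shifted rows `G̃_i` and the rows `G_i` have the
same coefficients below degree `N`; if moreover `G` is clean, so do the CLEANED shifted rows. [cite: HauserPerlega2024, Prop. 3 proof p. 792 l. 22–27 (y_∞ is well defined: the flags agree to ever higher order)] -/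
theorem coeff_cleanShift_rows_eq_of_lt {q r N : ℕ} (G Gs Gc : ℕ → PowerSeries K) (φ : PowerSeries K)
    (hφN : (N : ℕ∞) ≤ φ.order)
    (hGs : ∀ i a, PowerSeries.coeff a (Gs i) =
      ∑ k ∈ Finset.range (a + 1),
        (((i + k).choose i : ℕ) : K) * PowerSeries.coeff a (φ ^ k * G (i + k)))
    (hGc : ∀ i a, PowerSeries.coeff a (Gc i) =
      if q ∣ r + a ∧ q ∣ i then 0 else PowerSeries.coeff a (Gs i))
    (hclean : ∀ i a, PowerSeries.coeff a (G i) ≠ 0 → ¬ (q ∣ r + a ∧ q ∣ i)) :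
    ∀ i a, a < N → PowerSeries.coeff a (Gc i) = PowerSeries.coeff a (G i) := by
  intro i a haN
  have hs : PowerSeries.coeff a (Gs i) = PowerSeries.coeff a (G i) := by
    rw [hGs, Finset.sum_eq_single 0]
    · simp
    · intro k _ hk0
      rw [coeff_pow_mul_eq_zero_of_lt' (n := N) (m := 0) hφN (fun b hb => absurd hb (Nat.not_lt_zero b)) _,
        mul_zero]
      calc a < N := haN
        _ ≤ k * N := Nat.le_mul_of_pos_left N (Nat.pos_of_ne_zero hk0)
        _ = k * N + 0 := rfl
    · intro h; exact absurd (Finset.mem_range.mpr (Nat.succ_pos _)) h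
  rw [hGc, hs]
  split_ifs with hdvd
  · by_contra hne
    exact hclean i a (fun h0 => hne h0.symm) hdvd
  · rfl

/-- **`s = ∞` on rows**: if `min_{i<d} (d!/(d−i))·ord G_i = ⊤` then every row `G_i`, `i < d`, vanishes ("`s_𝓕 = ∞` …
`coeff_{d_res}(G₁) = 0`"). [cite: HauserPerlega2024, Prop. 3 proof p. 792 l. 31–34] -/
theorem rows_eq_zero_of_inf_eq_top {d : ℕ} (G : ℕ → PowerSeries K)
    (htop : (Finset.range d).inf (fun i => ((d.factorial / (d - i) : ℕ) : ℕ∞) * (G i).order) = ⊤) :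
    ∀ i, i < d → G i = 0 := by
  intro i hi
  have h1 : ((d.factorial / (d - i) : ℕ) : ℕ∞) * (G i).order = ⊤ := by
    apply eq_top_iff.mpr
    rw [← htop]
    exact Finset.inf_le (Finset.mem_range.mpr hi)
  by_contra hGi
  rw [← PowerSeries.coe_toNat_order hGi, ← Nat.cast_mul] at h1
  exact WithTop.natCast_ne_top _ h1

/-- **rows below the bound vanish**: if `d!·N ≤ min_{i<d} (d!/(d−i))·ord G_i` then every row `G_i`, `i < d`, vanishes
below degree `N` (as `d!/(d−i) ≤ d!`). [cite: HauserPerlega2024, Lemma 3 proof p. 791 l. 17–18 ("ord G_i ≥ (d−i)s/d!")] -/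
theorem coeff_rows_eq_zero_of_le_inf {d N : ℕ} (G : ℕ → PowerSeries K)
    (hle : ((d.factorial * N : ℕ) : ℕ∞) ≤
      (Finset.range d).inf (fun i => ((d.factorial / (d - i) : ℕ) : ℕ∞) * (G i).order)) :
    ∀ i, i < d → ∀ a, a < N → PowerSeries.coeff a (G i) = 0 := by
  intro i hi a ha
  apply PowerSeries.coeff_of_lt_order
  have hcd : d.factorial / (d - i) * (d - i) = d.factorial :=
    Nat.div_mul_cancel (Nat.dvd_factorial (by omega) (by omega))
  have hcpos : 0 < d.factorial / (d - i) :=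
    Nat.div_pos (le_trans (Nat.sub_le d i) (Nat.self_le_factorial d)) (by omega)
  have h1 : ((d.factorial * N : ℕ) : ℕ∞) ≤ ((d.factorial / (d - i) : ℕ) : ℕ∞) * (G i).order :=
    le_trans hle (Finset.inf_le (Finset.mem_range.mpr hi))
  by_cases hGi : G i = 0
  · rw [hGi, PowerSeries.order_zero]; exact WithTop.coe_lt_top _
  · rw [← PowerSeries.coe_toNat_order hGi] at h1 ⊢
    rw [← Nat.cast_mul, Nat.cast_le] at h1
    have h2 : N ≤ (G i).order.toNat := by
      by_contra hlt
      push Not at hlt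
      have h3 : d.factorial / (d - i) * (G i).order.toNat < d.factorial * N :=
        calc d.factorial / (d - i) * (G i).order.toNat
            ≤ d.factorial / (d - i) * (d - i) * (G i).order.toNat :=
              Nat.mul_le_mul_right _ (Nat.le_mul_of_pos_right _ (by omega))
          _ = d.factorial * (G i).order.toNat := by rw [hcd]
          _ < d.factorial * N := Nat.mul_lt_mul_of_pos_left hlt (Nat.factorial_pos d)
      omega
    exact_mod_cast lt_of_lt_of_le ha h2

end Rows

/-! ## B. Two letters: the triangular shift `y ↦ y + φ(x)`, its support, composition of shifts -/

section Shift

variable {σ : Type*} {K : Type*} [Field K]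

/-- the exponent `x^a y^b` evaluated at `x`. [folklore] -/
private theorem single_add_single_apply_left'' {x y : σ} (hxy : x ≠ y) (a b : ℕ) :
    (Finsupp.single x a + Finsupp.single y b) x = a := by
  classical
  rw [Finsupp.add_apply, Finsupp.single_eq_same, Finsupp.single_apply, if_neg (Ne.symm hxy), add_zero]

/-- the exponent `x^a y^b` evaluated at `y`. [folklore] -/
private theorem single_add_single_apply_right'' {x y : σ} (hxy : x ≠ y) (a b : ℕ) :
    (Finsupp.single x a + Finsupp.single y b) y = b := by
  classical
  rw [Finsupp.add_apply, Finsupp.single_eq_same, Finsupp.single_apply, if_neg hxy, zero_add]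

/-- two letters: an exponent is determined by its two entries. [folklore] -/
private theorem finsupp_eq_two'' {x y : σ} (hσ : ∀ l, l = x ∨ l = y) {d d' : σ →₀ ℕ} (hx : d x = d' x)
    (hy : d y = d' y) : d = d' := by
  ext l
  rcases hσ l with rfl | rfl
  · exact hx
  · exact hy

/-- two letters: every exponent is `x^{d_x} y^{d_y}`. [folklore] -/
private theorem eq_single_add_single' {x y : σ} (hxy : x ≠ y) (hσ : ∀ l, l = x ∨ l = y) (d : σ →₀ ℕ) :
    d = Finsupp.single x (d x) + Finsupp.single y (d y) :=
  finsupp_eq_two'' hσ (single_add_single_apply_left'' hxy _ _).symm (single_add_single_apply_right'' hxy _ _).symm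

/-- two letters: "all entries divisible by `q`" is the conjunction of the two divisibilities. [folklore] -/
private theorem forall_dvd_iff_two' {x y : σ} (hσ : ∀ l, l = x ∨ l = y) (q : ℕ) (d : σ →₀ ℕ) :
    (∀ l, q ∣ d l) ↔ q ∣ d x ∧ q ∣ d y := by
  refine ⟨fun h => ⟨h x, h y⟩, fun h l => ?_⟩
  rcases hσ l with rfl | rfl
  · exact h.1
  · exact h.2

open scoped Classical in
/-- a coefficient of the cleaning: `0` at `q`-divisible exponents, the original coefficient otherwise ("no `pᵉ`-th
powers appear in the expansion"). [cite: HauserPerlega2024, §2 p. 774 (clean expansion)] -/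
theorem coeff_cleanSeries (q : ℕ) (H : MvPowerSeries σ K) (d : σ →₀ ℕ) :
    MvPowerSeries.coeff d (cleanSeries q H) = if ∀ i, q ∣ d i then 0 else MvPowerSeries.coeff d H := rfl

/-- a surviving coefficient of the cleaning is the original coefficient, at a non-`q`-divisible exponent.
[cite: HauserPerlega2024, §2 p. 774 (clean expansion)] -/
theorem coeff_cleanSeries_of_ne_zero (q : ℕ) (H : MvPowerSeries σ K) (d : σ →₀ ℕ)
    (hd : MvPowerSeries.coeff d (cleanSeries q H) ≠ 0) :
    MvPowerSeries.coeff d (cleanSeries q H) = MvPowerSeries.coeff d H ∧ ¬ (∀ i, q ∣ d i) := by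
  classical
  rw [coeff_cleanSeries] at hd ⊢
  by_cases h : ∀ i, q ∣ d i
  · exact absurd (if_pos h) hd
  · rw [if_neg h]; exact ⟨rfl, h⟩

variable [Fintype σ] [DecidableEq σ]

/-- the triangular substitution `y ↦ y + φ(x)` is substitutable (`φ(0) = 0`) — the subordinate change "`y₁ = y + h(x)`".
[cite: HauserPerlega2024, Lemma 1 p. 788 (x₁ = x, y₁ = y + h(x))] -/
theorem hasSubst_shift (x y : σ) (φ : PowerSeries K) (hφ : PowerSeries.constantCoeff φ = 0) :
    MvPowerSeries.HasSubst (fun l => if l = y then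
      (MvPowerSeries.X y : MvPowerSeries σ K) + PowerSeries.subst (MvPowerSeries.X x : MvPowerSeries σ K) φ
      else MvPowerSeries.X l) := by
  refine MvPowerSeries.hasSubst_of_constantCoeff_zero fun l => ?_
  by_cases hl : l = y
  · simp only [hl, if_true, map_add, MvPowerSeries.constantCoeff_X, zero_add]
    exact PowerSeries.constantCoeff_subst_eq_zero (MvPowerSeries.constantCoeff_X x) φ hφ
  · simp only [if_neg hl, MvPowerSeries.constantCoeff_X]

/-- **The support of a triangular expansion**: a monomial `x^{m_x} y^{m_y}` of `H(x, y + φ(x))` comes from a monomial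
`x^{d_x} y^{d_y}` of `H` with `d_x ≤ m_x`, `m_y ≤ d_y` and `d_x + d_y ≤ m_x + m_y` (the shift raises `x`-exponents and
total degrees, lowers `y`-exponents). [cite: HauserPerlega2024, Lemma 3 proof p. 791 l. 20–28 (the expansion in x, y₁)] -/
theorem exists_coeff_ne_zero_of_coeff_subst_shift (x y : σ) (hxy : x ≠ y) (hσ : ∀ l, l = x ∨ l = y)
    (φ : PowerSeries K) (hφ : PowerSeries.constantCoeff φ = 0) (H : MvPowerSeries σ K) (m : σ →₀ ℕ)
    (hm : MvPowerSeries.coeff m (MvPowerSeries.subst (fun l => if l = y then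
        (MvPowerSeries.X y : MvPowerSeries σ K) + PowerSeries.subst (MvPowerSeries.X x : MvPowerSeries σ K) φ
        else MvPowerSeries.X l) H) ≠ 0) :
    ∃ d : σ →₀ ℕ, MvPowerSeries.coeff d H ≠ 0 ∧ d x ≤ m x ∧ m y ≤ d y ∧ d x + d y ≤ m x + m y := by
  classical
  have hHS := hasSubst_shift x y φ hφ
  rw [MvPowerSeries.coeff_subst hHS H m] at hm
  by_contra hnone
  push Not at hnone
  apply hm
  apply finsum_eq_zero_of_forall_eq_zero
  intro d
  by_cases hd : MvPowerSeries.coeff d H = 0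
  · rw [hd, zero_smul]
  · have huniv : (Finset.univ : Finset σ) = {x, y} := by
      ext l
      simp only [Finset.mem_univ, Finset.mem_insert, Finset.mem_singleton, true_iff]
      exact hσ l
    have hprod : (d.prod fun s n => (if s = y then
        (MvPowerSeries.X y : MvPowerSeries σ K) + PowerSeries.subst (MvPowerSeries.X x : MvPowerSeries σ K) φ
        else MvPowerSeries.X s) ^ n) =
        (MvPowerSeries.X x : MvPowerSeries σ K) ^ d x *
          (MvPowerSeries.X y + PowerSeries.subst (MvPowerSeries.X x : MvPowerSeries σ K) φ) ^ d y := by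
      rw [Finsupp.prod_fintype _ _ (fun l => pow_zero _), huniv, Finset.prod_pair hxy, if_neg hxy, if_pos rfl]
    rw [hprod, eq_single_add_single' hxy hσ m, coeff_X_pow_mul_X_add_pow x y hxy hσ φ (d x) (d y) (m x) (m y)]
    split_ifs with hcond
    · have h3 := hnone d hd hcond.1 hcond.2
      have hz : PowerSeries.coeff (m x - d x) (φ ^ (d y - m y)) = 0 := by
        apply PowerSeries.coeff_of_lt_order
        refine lt_of_lt_of_le ?_ (PowerSeries.le_order_pow_of_constantCoeff_eq_zero (d y - m y) hφ)
        exact_mod_cast (show m x - d x < d y - m y by omega)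
      rw [hz, mul_zero, smul_zero]
    · rw [smul_zero]

omit [Fintype σ] in
/-- the shift by `0` is the identity substitution (the flag `F₁ = V(z, y)` itself, `h₀ = 0`).
[cite: HauserPerlega2024, Prop. 3 proof p. 792 l. 19 (h₀ = 0)] -/
theorem subst_shift_zero (x y : σ) (H : MvPowerSeries σ K) :
    MvPowerSeries.subst (fun l => if l = y then
        (MvPowerSeries.X y : MvPowerSeries σ K) +
          PowerSeries.subst (MvPowerSeries.X x : MvPowerSeries σ K) (0 : PowerSeries K)
        else MvPowerSeries.X l) H = H := by
  have h0 : PowerSeries.subst (MvPowerSeries.X x : MvPowerSeries σ K) (0 : PowerSeries K) = 0 := by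
    rw [← PowerSeries.coe_substAlgHom (PowerSeries.HasSubst.X x), map_zero]
  have hfun : (fun l => if l = y then
      (MvPowerSeries.X y : MvPowerSeries σ K) +
        PowerSeries.subst (MvPowerSeries.X x : MvPowerSeries σ K) (0 : PowerSeries K)
      else MvPowerSeries.X l) = MvPowerSeries.X := by
    funext l
    by_cases hl : l = y
    · rw [if_pos hl, h0, add_zero, hl]
    · rw [if_neg hl]
  rw [hfun]
  exact congrFun MvPowerSeries.subst_self H

/-- **Composition of triangular shifts**: `y ↦ y + φ₁(x)` followed by `y ↦ y + φ₂(x)` is `y ↦ y + (φ₁ + φ₂)(x)` — the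
re-basing "`y_i := y + h_i`" used along the chain of flags in the printed proof. [cite: HauserPerlega2024, Prop. 3 proof p. 792 l. 20–24] -/
theorem subst_shift_subst_shift (x y : σ) (hxy : x ≠ y) (φ₁ φ₂ : PowerSeries K)
    (hφ₁ : PowerSeries.constantCoeff φ₁ = 0) (hφ₂ : PowerSeries.constantCoeff φ₂ = 0) (H : MvPowerSeries σ K) :
    MvPowerSeries.subst (fun l => if l = y then
        (MvPowerSeries.X y : MvPowerSeries σ K) + PowerSeries.subst (MvPowerSeries.X x : MvPowerSeries σ K) φ₂
        else MvPowerSeries.X l)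
      (MvPowerSeries.subst (fun l => if l = y then
        (MvPowerSeries.X y : MvPowerSeries σ K) + PowerSeries.subst (MvPowerSeries.X x : MvPowerSeries σ K) φ₁
        else MvPowerSeries.X l) H) =
    MvPowerSeries.subst (fun l => if l = y then
        (MvPowerSeries.X y : MvPowerSeries σ K) +
          PowerSeries.subst (MvPowerSeries.X x : MvPowerSeries σ K) (φ₁ + φ₂)
        else MvPowerSeries.X l) H := by
  have h1 := hasSubst_shift x y φ₁ hφ₁
  have h2 := hasSubst_shift x y φ₂ hφ₂
  have hψ₁ : MvPowerSeries.subst (fun l => if l = y then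
      (MvPowerSeries.X y : MvPowerSeries σ K) + PowerSeries.subst (MvPowerSeries.X x : MvPowerSeries σ K) φ₂
      else MvPowerSeries.X l) (PowerSeries.subst (MvPowerSeries.X x : MvPowerSeries σ K) φ₁) =
      PowerSeries.subst (MvPowerSeries.X x : MvPowerSeries σ K) φ₁ := by
    have e1 : PowerSeries.subst (MvPowerSeries.X x : MvPowerSeries σ K) φ₁ =
        MvPowerSeries.subst (fun _ : Unit => (MvPowerSeries.X x : MvPowerSeries σ K)) φ₁ :=
      PowerSeries.subst_def _ _
    rw [e1, MvPowerSeries.subst_comp_subst_apply (PowerSeries.HasSubst.const (PowerSeries.HasSubst.X x)) h2]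
    congr 1
    funext u
    rw [MvPowerSeries.subst_X h2, if_neg hxy]
  rw [MvPowerSeries.subst_comp_subst_apply h1 h2]
  congr 1
  funext l
  by_cases hl : l = y
  · simp only [hl, if_true]
    rw [MvPowerSeries.subst_add h2, MvPowerSeries.subst_X h2, if_pos rfl, hψ₁,
      PowerSeries.subst_add (PowerSeries.HasSubst.X x)]
    ring
  · simp only [if_neg hl]
    rw [MvPowerSeries.subst_X h2, if_neg hl]

end Shift

/-! ## C. Series level: the family of cleaned shifted expansions of a germ `H ∈ K[[x, y]]`

Throughout: two letters `x ≠ y`; `H ∈ K[[x, y]]` with `x^r ∣ H` (`hxr`); the rows RELATIVE TO `x^r` of the cleaned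
expansion `clean_q(H(x, y + φ(x)))`, `q = pᵉ`, are given as families `ℕ → K[[x]]` bound by their coefficients (no new
definition), and `s⟨φ⟩ = min_{i<d} (d!/(d−i))·ord(row i)` is the `Finset.inf` of `PointBlowupFlagShiftBound`.  For the
polynomial states of the atlas these are the rows of `residualFlat` and `sValue` (Section D); for the power-series germs
of the surface games they are the objects themselves. -/

section SeriesCore

variable {σ : Type*} [Fintype σ] [DecidableEq σ] {K : Type*} [Field K]

omit [Fintype σ] [DecidableEq σ] [Field K] in
/-- two letters: comparison of exponents is comparison of the two entries. [folklore] -/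
private theorem finsupp_le_iff_two'' {x y : σ} (hσ : ∀ l, l = x ∨ l = y) {f g : σ →₀ ℕ} :
    f ≤ g ↔ f x ≤ g x ∧ f y ≤ g y := by
  refine ⟨fun h => ⟨h x, h y⟩, fun h => ?_⟩
  intro l
  rcases hσ l with rfl | rfl
  · exact h.1
  · exact h.2

omit [Fintype σ] [DecidableEq σ] in
/-- unfolding the division by a monomial. [folklore] -/
private theorem coeff_divMonomial' (m d : σ →₀ ℕ) (H : MvPowerSeries σ K) :
    MvPowerSeries.coeff d (divMonomial m H) = MvPowerSeries.coeff (d + m) H := rfl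

/-- **Re-basing.**  The rows of `clean_q(H(x, y + φ₂(x)))` are the CLEANED SHIFTED ROWS, by `φ₂ − φ₁`, of the rows of
`clean_q(H(x, y + φ₁(x)))`: "`G̃_i = Σ_{j≥i} binom(j,i) h^{j−i} G_j`" followed by "all terms … which are not `pᵉ`th powers
also appear in the expansion of `F₁`" — composition of the two shifts and `clean ∘ subst ∘ clean = clean ∘ subst`
(`cleanSeries_subst_cleanSeries`).  This is the step "`y_i := y + h_i`" that lets Lemma 3 be applied between ANY two
members of a chain of flags. [cite: HauserPerlega2024, Lemma 3 proof p. 791 l. 20–32; Prop. 3 proof p. 792 l. 20–24] -/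
theorem coeff_cleanShift_rebase (p : ℕ) [Fact p.Prime] [CharP K p] (e : ℕ) (x y : σ) (hxy : x ≠ y)
    (hσ : ∀ l, l = x ∨ l = y) (H : MvPowerSeries σ K) (r : ℕ)
    (hxr : ∀ m, MvPowerSeries.coeff m H ≠ 0 → r ≤ m x) (φ₁ φ₂ : PowerSeries K)
    (hφ₁ : PowerSeries.constantCoeff φ₁ = 0) (hφ₂ : PowerSeries.constantCoeff φ₂ = 0)
    (R₁ : ℕ → PowerSeries K)
    (hR₁ : ∀ j v, PowerSeries.coeff v (R₁ j) = MvPowerSeries.coeff (Finsupp.single x (r + v) + Finsupp.single y j)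
      (cleanSeries (p ^ e) (MvPowerSeries.subst (fun l => if l = y then
        (MvPowerSeries.X y : MvPowerSeries σ K) + PowerSeries.subst (MvPowerSeries.X x : MvPowerSeries σ K) φ₁
        else MvPowerSeries.X l) H)))
    (i a : ℕ) :
    MvPowerSeries.coeff (Finsupp.single x (r + a) + Finsupp.single y i)
        (cleanSeries (p ^ e) (MvPowerSeries.subst (fun l => if l = y then
        (MvPowerSeries.X y : MvPowerSeries σ K) + PowerSeries.subst (MvPowerSeries.X x : MvPowerSeries σ K) φ₂
        else MvPowerSeries.X l) H)) =
      if p ^ e ∣ r + a ∧ p ^ e ∣ i then 0 else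
        ∑ k ∈ Finset.range (a + 1),
          (((i + k).choose i : ℕ) : K) * PowerSeries.coeff a ((φ₂ - φ₁) ^ k * R₁ (i + k)) := by
  classical
  have hφ21 : PowerSeries.constantCoeff (φ₂ - φ₁) = 0 := by rw [map_sub, hφ₁, hφ₂, sub_zero]
  have hcomp : MvPowerSeries.subst (fun l => if l = y then
        (MvPowerSeries.X y : MvPowerSeries σ K) + PowerSeries.subst (MvPowerSeries.X x : MvPowerSeries σ K) φ₂
        else MvPowerSeries.X l) H =
      MvPowerSeries.subst (fun l => if l = y then
        (MvPowerSeries.X y : MvPowerSeries σ K) + PowerSeries.subst (MvPowerSeries.X x : MvPowerSeries σ K) (φ₂ - φ₁)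
        else MvPowerSeries.X l)
        (MvPowerSeries.subst (fun l => if l = y then
        (MvPowerSeries.X y : MvPowerSeries σ K) + PowerSeries.subst (MvPowerSeries.X x : MvPowerSeries σ K) φ₁
        else MvPowerSeries.X l) H) := by
    rw [subst_shift_subst_shift x y hxy φ₁ (φ₂ - φ₁) hφ₁ hφ21 H, add_sub_cancel]
  set C₁ := cleanSeries (p ^ e) (MvPowerSeries.subst (fun l => if l = y then
        (MvPowerSeries.X y : MvPowerSeries σ K) + PowerSeries.subst (MvPowerSeries.X x : MvPowerSeries σ K) φ₁
        else MvPowerSeries.X l) H) with hC₁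
  have hxr₁ : ∀ m, MvPowerSeries.coeff m C₁ ≠ 0 → r ≤ m x := by
    intro m hm
    have h1 := (coeff_cleanSeries_of_ne_zero (p ^ e) _ m hm).1
    rw [h1] at hm
    obtain ⟨d, hd, hdx, -, -⟩ := exists_coeff_ne_zero_of_coeff_subst_shift x y hxy hσ φ₁ hφ₁ H m hm
    exact le_trans (hxr d hd) hdx
  rw [hcomp, ← cleanSeries_subst_cleanSeries p e (hasSubst_shift x y (φ₂ - φ₁) hφ21), ← hC₁, coeff_cleanSeries]
  simp only [forall_dvd_iff_two' hσ, single_add_single_apply_left'' hxy, single_add_single_apply_right'' hxy]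
  split_ifs with hdvd
  · rfl
  · exact coeff_subst_triangular_row x y hxy hσ (φ₂ - φ₁) hφ21 C₁ r hxr₁ R₁ hR₁ i a

omit [Fintype σ] [DecidableEq σ] in
/-- the rows of a cleaned expansion are clean: no coefficient `[x^a yⁱ]` with `q ∣ r + a` and `q ∣ i`.
[cite: HauserPerlega2024, §5 p. 783 (clean expansion)] -/
theorem cleanShift_rows_clean (q : ℕ) (x y : σ) (hxy : x ≠ y) (hσ : ∀ l, l = x ∨ l = y) (S : MvPowerSeries σ K)
    (r : ℕ) (R : ℕ → PowerSeries K)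
    (hR : ∀ j v, PowerSeries.coeff v (R j) =
      MvPowerSeries.coeff (Finsupp.single x (r + v) + Finsupp.single y j) (cleanSeries q S)) :
    ∀ i a, PowerSeries.coeff a (R i) ≠ 0 → ¬ (q ∣ r + a ∧ q ∣ i) := by
  intro i a h
  rw [hR] at h
  have h2 := (coeff_cleanSeries_of_ne_zero q _ _ h).2
  rwa [forall_dvd_iff_two' hσ, single_add_single_apply_left'' hxy, single_add_single_apply_right'' hxy] at h2

/-- **the order bound survives**: if every monomial of `H` has degree `≥ r + d`, every row `i` of a cleaned shifted
expansion (relative to `x^r`) vanishes below degree `d − i`. [cite: HauserPerlega2024, Prop. 3 proof p. 792 l. 36–37 ("G₁ … ord")] -/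
theorem cleanShift_rows_degree_ge (q : ℕ) (x y : σ) (hxy : x ≠ y) (hσ : ∀ l, l = x ∨ l = y)
    (H : MvPowerSeries σ K) (r d : ℕ) (hminH : ∀ m, MvPowerSeries.coeff m H ≠ 0 → r + d ≤ m x + m y)
    (φ : PowerSeries K) (hφ : PowerSeries.constantCoeff φ = 0) (R : ℕ → PowerSeries K)
    (hR : ∀ j v, PowerSeries.coeff v (R j) = MvPowerSeries.coeff (Finsupp.single x (r + v) + Finsupp.single y j)
      (cleanSeries q (MvPowerSeries.subst (fun l => if l = y then
        (MvPowerSeries.X y : MvPowerSeries σ K) + PowerSeries.subst (MvPowerSeries.X x : MvPowerSeries σ K) φ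
        else MvPowerSeries.X l) H))) :
    ∀ i a, PowerSeries.coeff a (R i) ≠ 0 → d ≤ i + a := by
  intro i a h
  rw [hR] at h
  have h1 := (coeff_cleanSeries_of_ne_zero q _ _ h).1
  rw [h1] at h
  obtain ⟨dd, hdd, -, -, hdeg⟩ := exists_coeff_ne_zero_of_coeff_subst_shift x y hxy hσ φ hφ H _ h
  have h2 := hminH dd hdd
  rw [single_add_single_apply_left'' hxy, single_add_single_apply_right'' hxy] at hdeg
  omega

/-- **a clean term of degree `d` survives** (series level): if `H` has all monomials of degree `≥ r + d` and its
cleaning has one of degree `r + d`, then every cleaned shifted expansion has, relative to `x^r`, a row coefficient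
`[x^a yⁱ] ≠ 0` with `i + a = d` — "`ord G₁ = d_res`". [cite: HauserPerlega2024, Lemma 3 proof p. 791 l. 10–12; Prop. 3 proof p. 792 l. 36–38] -/
theorem cleanShift_rows_exists_degree_eq (p : ℕ) [Fact p.Prime] [CharP K p] (e : ℕ) (x y : σ) (hxy : x ≠ y)
    (hσ : ∀ l, l = x ∨ l = y) (H : MvPowerSeries σ K) (r d : ℕ)
    (hxr : ∀ m, MvPowerSeries.coeff m H ≠ 0 → r ≤ m x)
    (hminH : ∀ m, MvPowerSeries.coeff m H ≠ 0 → r + d ≤ m x + m y)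
    (hexH : ∃ m, MvPowerSeries.coeff m (cleanSeries (p ^ e) H) ≠ 0 ∧ m x + m y = r + d)
    (φ : PowerSeries K) (hφ : PowerSeries.constantCoeff φ = 0) (R : ℕ → PowerSeries K)
    (hR : ∀ j v, PowerSeries.coeff v (R j) = MvPowerSeries.coeff (Finsupp.single x (r + v) + Finsupp.single y j)
      (cleanSeries (p ^ e) (MvPowerSeries.subst (fun l => if l = y then
        (MvPowerSeries.X y : MvPowerSeries σ K) + PowerSeries.subst (MvPowerSeries.X x : MvPowerSeries σ K) φ
        else MvPowerSeries.X l) H))) :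
    ∃ i a, PowerSeries.coeff a (R i) ≠ 0 ∧ i + a = d := by
  classical
  -- base rows: the rows of `clean_q H` itself (= the flag `φ = 0`)
  set G : ℕ → PowerSeries K := fun j => PowerSeries.mk fun v =>
    MvPowerSeries.coeff (Finsupp.single x (r + v) + Finsupp.single y j) (cleanSeries (p ^ e) H) with hGdef
  have hG' : ∀ j v, PowerSeries.coeff v (G j) =
      MvPowerSeries.coeff (Finsupp.single x (r + v) + Finsupp.single y j) (cleanSeries (p ^ e) H) := fun j v => by
    rw [hGdef, PowerSeries.coeff_mk]
  have hG : ∀ j v, PowerSeries.coeff v (G j) = MvPowerSeries.coeff (Finsupp.single x (r + v) + Finsupp.single y j)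
      (cleanSeries (p ^ e) (MvPowerSeries.subst (fun l => if l = y then
        (MvPowerSeries.X y : MvPowerSeries σ K) + PowerSeries.subst (MvPowerSeries.X x : MvPowerSeries σ K) (0 : PowerSeries K)
        else MvPowerSeries.X l) H)) := fun j v => by
    rw [subst_shift_zero, hG']
  have h00 : PowerSeries.constantCoeff (0 : PowerSeries K) = 0 := map_zero _
  have hφ0' : PowerSeries.constantCoeff (φ - 0) = 0 := by rw [sub_zero, hφ]
  set Gs : ℕ → PowerSeries K := fun i => PowerSeries.mk fun a =>
    ∑ k ∈ Finset.range (a + 1), (((i + k).choose i : ℕ) : K) * PowerSeries.coeff a ((φ - 0) ^ k * G (i + k))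
    with hGsdef
  have hGs : ∀ i a, PowerSeries.coeff a (Gs i) =
      ∑ k ∈ Finset.range (a + 1), (((i + k).choose i : ℕ) : K) * PowerSeries.coeff a ((φ - 0) ^ k * G (i + k)) :=
    fun i a => by rw [hGsdef, PowerSeries.coeff_mk]
  have hGc : ∀ i a, PowerSeries.coeff a (R i) =
      if p ^ e ∣ r + a ∧ p ^ e ∣ i then 0 else PowerSeries.coeff a (Gs i) := fun i a => by
    rw [hR, coeff_cleanShift_rebase p e x y hxy hσ H r hxr 0 φ h00 hφ G hG i a, hGs]
  have hcleanG := cleanShift_rows_clean (p ^ e) x y hxy hσ H r G hG'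
  have hminG : ∀ i a, PowerSeries.coeff a (G i) ≠ 0 → d ≤ i + a := by
    intro i a h
    rw [hG'] at h
    have h1 := (coeff_cleanSeries_of_ne_zero (p ^ e) _ _ h).1
    rw [h1] at h
    have h2 := hminH _ h
    rw [single_add_single_apply_left'' hxy, single_add_single_apply_right'' hxy] at h2
    omega
  have hexG : ∃ i a, PowerSeries.coeff a (G i) ≠ 0 ∧ i + a = d := by
    obtain ⟨m, hm, hdeg⟩ := hexH
    have hmx : r ≤ m x := by
      have h1 := (coeff_cleanSeries_of_ne_zero (p ^ e) _ _ hm).1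
      rw [h1] at hm
      exact hxr m hm
    refine ⟨m y, m x - r, ?_, by omega⟩
    rw [hG', show r + (m x - r) = m x by omega, ← eq_single_add_single' hxy hσ m]
    exact hm
  exact exists_clean_degree_term_of_shift G Gs R (φ - 0) hφ0' hGs hGc hcleanG hminG hexG

/-- **[HP24, Lemma 3] between any two case-(i) flags** (series level): for `H` as above with `d ≥ pᵉ` and two shifts
`φ₁, φ₂`, if `s⟨φ₁⟩ < s⟨φ₂⟩` then `d!·ord(φ₂ − φ₁) = s⟨φ₁⟩` — Lemma 3 after the re-basing `y₁ := y + h₁`, i.e. for the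
pair `𝓕 = ⟨y,x,h₁⟩`, `𝓖 = ⟨y,x,h₂⟩` ("ord(h_{i+1} − h_i) = s_{𝓕^i}/d!").
[cite: HauserPerlega2024, Lemma 3 p. 791 l. 2–5; Prop. 3 proof p. 792 l. 20–24] -/
theorem factorial_mul_order_sub_eq_inf_rows_of_lt (p : ℕ) [Fact p.Prime] [CharP K p] {e : ℕ} (x y : σ)
    (hxy : x ≠ y) (hσ : ∀ l, l = x ∨ l = y) (H : MvPowerSeries σ K) (r d : ℕ) (hq : p ^ e ≤ d)
    (hxr : ∀ m, MvPowerSeries.coeff m H ≠ 0 → r ≤ m x)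
    (hminH : ∀ m, MvPowerSeries.coeff m H ≠ 0 → r + d ≤ m x + m y)
    (hexH : ∃ m, MvPowerSeries.coeff m (cleanSeries (p ^ e) H) ≠ 0 ∧ m x + m y = r + d)
    (φ₁ φ₂ : PowerSeries K) (hφ₁ : PowerSeries.constantCoeff φ₁ = 0) (hφ₂ : PowerSeries.constantCoeff φ₂ = 0)
    (R₁ R₂ : ℕ → PowerSeries K)
    (hR₁ : ∀ j v, PowerSeries.coeff v (R₁ j) = MvPowerSeries.coeff (Finsupp.single x (r + v) + Finsupp.single y j)
      (cleanSeries (p ^ e) (MvPowerSeries.subst (fun l => if l = y then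
        (MvPowerSeries.X y : MvPowerSeries σ K) + PowerSeries.subst (MvPowerSeries.X x : MvPowerSeries σ K) φ₁
        else MvPowerSeries.X l) H)))
    (hR₂ : ∀ j v, PowerSeries.coeff v (R₂ j) = MvPowerSeries.coeff (Finsupp.single x (r + v) + Finsupp.single y j)
      (cleanSeries (p ^ e) (MvPowerSeries.subst (fun l => if l = y then
        (MvPowerSeries.X y : MvPowerSeries σ K) + PowerSeries.subst (MvPowerSeries.X x : MvPowerSeries σ K) φ₂
        else MvPowerSeries.X l) H)))
    (hlt : (Finset.range d).inf (fun i => ((d.factorial / (d - i) : ℕ) : ℕ∞) * (R₁ i).order) <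
      (Finset.range d).inf (fun i => ((d.factorial / (d - i) : ℕ) : ℕ∞) * (R₂ i).order)) :
    (d.factorial : ℕ∞) * (φ₂ - φ₁).order =
      (Finset.range d).inf (fun i => ((d.factorial / (d - i) : ℕ) : ℕ∞) * (R₁ i).order) := by
  classical
  have hφ21 : PowerSeries.constantCoeff (φ₂ - φ₁) = 0 := by rw [map_sub, hφ₁, hφ₂, sub_zero]
  set Gs : ℕ → PowerSeries K := fun i => PowerSeries.mk fun a =>
    ∑ k ∈ Finset.range (a + 1), (((i + k).choose i : ℕ) : K) * PowerSeries.coeff a ((φ₂ - φ₁) ^ k * R₁ (i + k))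
    with hGsdef
  have hGs : ∀ i a, PowerSeries.coeff a (Gs i) =
      ∑ k ∈ Finset.range (a + 1), (((i + k).choose i : ℕ) : K) * PowerSeries.coeff a ((φ₂ - φ₁) ^ k * R₁ (i + k)) :=
    fun i a => by rw [hGsdef, PowerSeries.coeff_mk]
  have hGc : ∀ i a, PowerSeries.coeff a (R₂ i) =
      if p ^ e ∣ r + a ∧ p ^ e ∣ i then 0 else PowerSeries.coeff a (Gs i) := fun i a => by
    rw [hR₂, coeff_cleanShift_rebase p e x y hxy hσ H r hxr φ₁ φ₂ hφ₁ hφ₂ R₁ hR₁ i a, hGs]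
  have hclean₁ := cleanShift_rows_clean (p ^ e) x y hxy hσ _ r R₁ hR₁
  have hex₁ := cleanShift_rows_exists_degree_eq p e x y hxy hσ H r d hxr hminH hexH φ₁ hφ₁ R₁ hR₁
  exact factorial_mul_order_shift_eq_of_lt p hq R₁ Gs R₂ (φ₂ - φ₁) hφ21 hGs hGc hclean₁ hex₁ hlt

/-- **two cleaned shifted expansions agree below the order of the difference of their shifts**: if
`ord(φ₂ − φ₁) ≥ N`, the rows of `clean_q(H(x, y + φ₂))` and of `clean_q(H(x, y + φ₁))` have the same coefficients below
degree `N` ("`y_∞` … is a well-defined power series": the flags of the chain agree to ever higher order).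
[cite: HauserPerlega2024, Prop. 3 proof p. 792 l. 22–27] -/
theorem coeff_cleanShift_rows_eq_of_le_order (p : ℕ) [Fact p.Prime] [CharP K p] {e : ℕ} (x y : σ)
    (hxy : x ≠ y) (hσ : ∀ l, l = x ∨ l = y) (H : MvPowerSeries σ K) (r : ℕ)
    (hxr : ∀ m, MvPowerSeries.coeff m H ≠ 0 → r ≤ m x)
    (φ₁ φ₂ : PowerSeries K) (hφ₁ : PowerSeries.constantCoeff φ₁ = 0) (hφ₂ : PowerSeries.constantCoeff φ₂ = 0)
    (R₁ R₂ : ℕ → PowerSeries K)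
    (hR₁ : ∀ j v, PowerSeries.coeff v (R₁ j) = MvPowerSeries.coeff (Finsupp.single x (r + v) + Finsupp.single y j)
      (cleanSeries (p ^ e) (MvPowerSeries.subst (fun l => if l = y then
        (MvPowerSeries.X y : MvPowerSeries σ K) + PowerSeries.subst (MvPowerSeries.X x : MvPowerSeries σ K) φ₁
        else MvPowerSeries.X l) H)))
    (hR₂ : ∀ j v, PowerSeries.coeff v (R₂ j) = MvPowerSeries.coeff (Finsupp.single x (r + v) + Finsupp.single y j)
      (cleanSeries (p ^ e) (MvPowerSeries.subst (fun l => if l = y then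
        (MvPowerSeries.X y : MvPowerSeries σ K) + PowerSeries.subst (MvPowerSeries.X x : MvPowerSeries σ K) φ₂
        else MvPowerSeries.X l) H)))
    {N : ℕ} (hN : (N : ℕ∞) ≤ (φ₂ - φ₁).order) :
    ∀ i a, a < N → PowerSeries.coeff a (R₂ i) = PowerSeries.coeff a (R₁ i) := by
  classical
  have hφ21 : PowerSeries.constantCoeff (φ₂ - φ₁) = 0 := by rw [map_sub, hφ₁, hφ₂, sub_zero]
  set Gs : ℕ → PowerSeries K := fun i => PowerSeries.mk fun a =>
    ∑ k ∈ Finset.range (a + 1), (((i + k).choose i : ℕ) : K) * PowerSeries.coeff a ((φ₂ - φ₁) ^ k * R₁ (i + k))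
    with hGsdef
  have hGs : ∀ i a, PowerSeries.coeff a (Gs i) =
      ∑ k ∈ Finset.range (a + 1), (((i + k).choose i : ℕ) : K) * PowerSeries.coeff a ((φ₂ - φ₁) ^ k * R₁ (i + k)) :=
    fun i a => by rw [hGsdef, PowerSeries.coeff_mk]
  have hGc : ∀ i a, PowerSeries.coeff a (R₂ i) =
      if p ^ e ∣ r + a ∧ p ^ e ∣ i then 0 else PowerSeries.coeff a (Gs i) := fun i a => by
    rw [hR₂, coeff_cleanShift_rebase p e x y hxy hσ H r hxr φ₁ φ₂ hφ₁ hφ₂ R₁ hR₁ i a, hGs]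
  have hclean₁ := cleanShift_rows_clean (p ^ e) x y hxy hσ _ r R₁ hR₁
  exact coeff_cleanShift_rows_eq_of_lt R₁ Gs R₂ (φ₂ - φ₁) hN hGs hGc hclean₁


/-- **The limit flag (`y_∞`).**  For `H` as above (`d ≥ pᵉ`) and the rows `R φ` of all cleaned shifted expansions:
EITHER some shift has `s⟨φ⟩ = ∞`, OR `s⟨φ⟩` is bounded over all shifts.  Printed argument: an unbounded chain
`s⟨φ₀⟩ < s⟨φ₁⟩ < ⋯` has `ord(φ_{j+1} − φ_j) = s⟨φ_j⟩/d! → ∞` by Lemma 3, so "`y_∞ = y + Σ (h_{i+1} − h_i)` is a well-defined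
power series", and the rows `i < d` of its cleaned expansion vanish to every order, i.e. "`s_𝓕 = ∞`".
[cite: HauserPerlega2024, Prop. 3 proof p. 792 l. 14–30] -/
theorem exists_inf_rows_eq_top_or_bounded (p : ℕ) [Fact p.Prime] [CharP K p] {e : ℕ} (x y : σ) (hxy : x ≠ y)
    (hσ : ∀ l, l = x ∨ l = y) (H : MvPowerSeries σ K) (r d : ℕ) (hq : p ^ e ≤ d)
    (hxr : ∀ m, MvPowerSeries.coeff m H ≠ 0 → r ≤ m x)
    (hminH : ∀ m, MvPowerSeries.coeff m H ≠ 0 → r + d ≤ m x + m y)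
    (hexH : ∃ m, MvPowerSeries.coeff m (cleanSeries (p ^ e) H) ≠ 0 ∧ m x + m y = r + d)
    (R : PowerSeries K → ℕ → PowerSeries K)
    (hR : ∀ φ j v, PowerSeries.coeff v (R φ j) = MvPowerSeries.coeff (Finsupp.single x (r + v) + Finsupp.single y j)
      (cleanSeries (p ^ e) (MvPowerSeries.subst (fun l => if l = y then
        (MvPowerSeries.X y : MvPowerSeries σ K) + PowerSeries.subst (MvPowerSeries.X x : MvPowerSeries σ K) φ
        else MvPowerSeries.X l) H))) :
    (∃ φ : PowerSeries K, PowerSeries.constantCoeff φ = 0 ∧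
        (Finset.range d).inf (fun i => ((d.factorial / (d - i) : ℕ) : ℕ∞) * (R φ i).order) = ⊤) ∨
      (∃ B : ℕ, ∀ φ : PowerSeries K, PowerSeries.constantCoeff φ = 0 →
        (Finset.range d).inf (fun i => ((d.factorial / (d - i) : ℕ) : ℕ∞) * (R φ i).order) ≤ B) := by
  classical
  set s : PowerSeries K → ℕ∞ := fun φ =>
    (Finset.range d).inf (fun i => ((d.factorial / (d - i) : ℕ) : ℕ∞) * (R φ i).order) with hsdef
  by_contra hcon
  push Not at hcon
  obtain ⟨hfin, hunb⟩ := hcon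
  have hp := (Fact.out : p.Prime)
  have hd1 : 1 ≤ d := le_trans (Nat.one_le_pow _ _ hp.pos) hq
  -- a shift beating any given bound
  choose f hf0 hfB using hunb
  -- the chain `φ₀ = 0`, `φ_{j+1} = f(s⟨φ_j⟩)`
  let c : ℕ → PowerSeries K := fun n => Nat.rec (0 : PowerSeries K) (fun _ cj => f (s cj).toNat) n
  have hc0 : c 0 = 0 := rfl
  have hcs : ∀ j, c (j + 1) = f (s (c j)).toNat := fun j => rfl
  have hcc : ∀ j, PowerSeries.constantCoeff (c j) = 0 := by
    intro j
    induction j with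
    | zero => rw [hc0, map_zero]
    | succ j _ => rw [hcs]; exact hf0 _
  have hne : ∀ j, s (c j) ≠ ⊤ := fun j => hfin (c j) (hcc j)
  have hlt : ∀ j, s (c j) < s (c (j + 1)) := by
    intro j
    have h1 := hfB (s (c j)).toNat
    rw [ENat.coe_toNat (hne j)] at h1
    rw [hcs]
    exact h1
  -- Lemma 3 along the chain: `d! · ord(φ_{j+1} − φ_j) = s⟨φ_j⟩`
  have hL3 : ∀ j, (d.factorial : ℕ∞) * (c (j + 1) - c j).order = s (c j) := fun j =>
    factorial_mul_order_sub_eq_inf_rows_of_lt p x y hxy hσ H r d hq hxr hminH hexH (c j) (c (j + 1)) (hcc j)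
      (hcc (j + 1)) (R (c j)) (R (c (j + 1))) (hR (c j)) (hR (c (j + 1))) (hlt j)
  -- `N_j = ord(φ_{j+1} − φ_j)` is finite, `s⟨φ_j⟩ = d!·N_j`, and `N` is strictly increasing
  set N : ℕ → ℕ := fun j => (c (j + 1) - c j).order.toNat with hNdef
  have hNord : ∀ j, (c (j + 1) - c j).order = N j := by
    intro j
    have h1 : (c (j + 1) - c j).order ≠ ⊤ := by
      intro htop
      apply hne j
      rw [← hL3 j, htop, ENat.mul_top (by exact_mod_cast (Nat.factorial_pos d).ne')]
    exact (ENat.coe_toNat h1).symm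
  have hsN : ∀ j, s (c j) = ((d.factorial * N j : ℕ) : ℕ∞) := by
    intro j
    rw [← hL3 j, hNord j, Nat.cast_mul]
  have hNlt : ∀ j, N j < N (j + 1) := by
    intro j
    have h1 := hlt j
    rw [hsN j, hsN (j + 1), Nat.cast_lt] at h1
    exact Nat.lt_of_mul_lt_mul_left h1
  have hNmono : StrictMono N := strictMono_nat_of_lt_succ hNlt
  have hNge : ∀ j, j ≤ N j := fun j => hNmono.le_apply
  -- ultrametric: `ord(φ_{j'} − φ_j) ≥ N_j` for `j ≤ j'`
  have hultra : ∀ j j', j ≤ j' → (N j : ℕ∞) ≤ (c j' - c j).order := by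
    intro j j' hjj'
    induction j', hjj' using Nat.le_induction with
    | base => rw [sub_self, PowerSeries.order_zero]; exact le_top
    | succ j' hjj' ih =>
      have h1 : c (j' + 1) - c j = (c (j' + 1) - c j') + (c j' - c j) := by ring
      rw [h1]
      refine le_trans ?_ (PowerSeries.min_order_le_order_add _ _)
      refine le_min ?_ ih
      rw [hNord j']
      exact_mod_cast hNmono.monotone hjj'
  -- the limit shift `φ_∞`
  set φinf : PowerSeries K := PowerSeries.mk fun a => PowerSeries.coeff a (c (a + 1)) with hφinf
  have hφinf0 : PowerSeries.constantCoeff φinf = 0 := by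
    rw [← PowerSeries.coeff_zero_eq_constantCoeff_apply, hφinf, PowerSeries.coeff_mk, zero_add,
      PowerSeries.coeff_zero_eq_constantCoeff_apply]
    exact hcc 1
  have hclose : ∀ j, (N j : ℕ∞) ≤ (φinf - c j).order := by
    intro j
    refine PowerSeries.nat_le_order _ _ fun a ha => ?_
    rw [map_sub, hφinf, PowerSeries.coeff_mk, sub_eq_zero]
    rcases le_or_gt (a + 1) j with h1 | h1
    · -- `a + 1 ≤ j`: `ord(φ_j − φ_{a+1}) ≥ N_{a+1} > a`
      have h2 := hultra (a + 1) j h1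
      have h3 : (a : ℕ∞) < (c j - c (a + 1)).order :=
        lt_of_lt_of_le (by exact_mod_cast Nat.lt_of_lt_of_le (Nat.lt_succ_self a) (hNge (a + 1))) h2
      have h4 := PowerSeries.coeff_of_lt_order a h3
      rw [map_sub, sub_eq_zero] at h4
      exact h4.symm
    · -- `j ≤ a + 1`: `ord(φ_{a+1} − φ_j) ≥ N_j > a`
      have h2 := hultra j (a + 1) (by omega)
      have h3 : (a : ℕ∞) < (c (a + 1) - c j).order := lt_of_lt_of_le (by exact_mod_cast ha) h2
      have h4 := PowerSeries.coeff_of_lt_order a h3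
      rw [map_sub, sub_eq_zero] at h4
      exact h4
  -- the rows `i < d` of the limit expansion vanish below every `N_j`, hence vanish
  have hrows : ∀ j i, i < d → ∀ a, a < N j → PowerSeries.coeff a (R φinf i) = 0 := by
    intro j i hi a ha
    rw [coeff_cleanShift_rows_eq_of_le_order p x y hxy hσ H r hxr (c j) φinf (hcc j) hφinf0 (R (c j)) (R φinf)
      (hR (c j)) (hR φinf) (hclose j) i a ha]
    exact coeff_rows_eq_zero_of_le_inf (R (c j)) (by rw [← hsN j]) i hi a ha
  have hzero : ∀ i, i < d → R φinf i = 0 := by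
    intro i hi
    ext a
    rw [map_zero]
    exact hrows (a + 1) i hi a (Nat.lt_of_lt_of_le (Nat.lt_succ_self a) (hNge (a + 1)))
  -- so `s⟨φ_∞⟩ = ∞`, contradicting finiteness
  apply hfin φinf hφinf0
  refine top_le_iff.mp (Finset.le_inf fun i hi => ?_)
  rw [Finset.mem_range] at hi
  rw [hzero i hi, PowerSeries.order_zero, ENat.mul_top (by
    exact_mod_cast (Nat.div_pos (le_trans (Nat.sub_le d i) (Nat.self_le_factorial d)) (by omega)).ne')]

/-- **`s = ∞` is the (hidden) monomial case** (series level): if `s⟨φ⟩ = ∞` then the rows `i < d` vanish and, by the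
surviving clean degree-`d` term, row `d` is a unit: `clean_q(H(x, y + φ)) = x^r·y^d·u`, `u(0) ≠ 0`, `(r, d) ∉ q·ℕ²` —
"`coeff_{d_res}(G₁) = 0` … `G₁ = y₁^{d_res}·u` for some unit `u` … `X` is in the monomial case at `a`".
[cite: HauserPerlega2024, Prop. 3 proof p. 792 l. 31–40] -/
theorem exists_eq_monomial_mul_of_inf_rows_eq_top (p : ℕ) [Fact p.Prime] [CharP K p] {e : ℕ} (x y : σ)
    (hxy : x ≠ y) (hσ : ∀ l, l = x ∨ l = y) (H : MvPowerSeries σ K) (r d : ℕ)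
    (hxr : ∀ m, MvPowerSeries.coeff m H ≠ 0 → r ≤ m x)
    (hminH : ∀ m, MvPowerSeries.coeff m H ≠ 0 → r + d ≤ m x + m y)
    (hexH : ∃ m, MvPowerSeries.coeff m (cleanSeries (p ^ e) H) ≠ 0 ∧ m x + m y = r + d)
    (φ : PowerSeries K) (hφ : PowerSeries.constantCoeff φ = 0) (R : ℕ → PowerSeries K)
    (hR : ∀ j v, PowerSeries.coeff v (R j) = MvPowerSeries.coeff (Finsupp.single x (r + v) + Finsupp.single y j)
      (cleanSeries (p ^ e) (MvPowerSeries.subst (fun l => if l = y then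
        (MvPowerSeries.X y : MvPowerSeries σ K) + PowerSeries.subst (MvPowerSeries.X x : MvPowerSeries σ K) φ
        else MvPowerSeries.X l) H)))
    (htop : (Finset.range d).inf (fun i => ((d.factorial / (d - i) : ℕ) : ℕ∞) * (R i).order) = ⊤) :
    ∃ u : MvPowerSeries σ K,
      cleanSeries (p ^ e) (MvPowerSeries.subst (fun l => if l = y then
        (MvPowerSeries.X y : MvPowerSeries σ K) + PowerSeries.subst (MvPowerSeries.X x : MvPowerSeries σ K) φ
        else MvPowerSeries.X l) H) =
          MvPowerSeries.monomial (Finsupp.single x r + Finsupp.single y d) (1 : K) * u ∧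
        MvPowerSeries.constantCoeff u ≠ 0 ∧ ¬ (p ^ e ∣ r ∧ p ^ e ∣ d) := by
  classical
  set C := cleanSeries (p ^ e) (MvPowerSeries.subst (fun l => if l = y then
        (MvPowerSeries.X y : MvPowerSeries σ K) + PowerSeries.subst (MvPowerSeries.X x : MvPowerSeries σ K) φ
        else MvPowerSeries.X l) H) with hC
  have hzero := rows_eq_zero_of_inf_eq_top R htop
  obtain ⟨i, a, hia, hsum⟩ := cleanShift_rows_exists_degree_eq p e x y hxy hσ H r d hxr hminH hexH φ hφ R hR
  have hid : i = d := by
    by_contra hne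
    have h1 := hzero i (by omega)
    rw [h1, map_zero] at hia
    exact hia rfl
  have ha0 : a = 0 := by omega
  subst hid ha0
  set n₀ : σ →₀ ℕ := Finsupp.single x r + Finsupp.single y i with hn₀
  have hkey : MvPowerSeries.coeff n₀ C ≠ 0 := by rw [hR, Nat.add_zero] at hia; exact hia
  have hxrC : ∀ m, MvPowerSeries.coeff m C ≠ 0 → r ≤ m x := by
    intro m hm
    have h1 := (coeff_cleanSeries_of_ne_zero (p ^ e) _ m hm).1
    rw [h1] at hm
    obtain ⟨dd, hdd, hdx, -, -⟩ := exists_coeff_ne_zero_of_coeff_subst_shift x y hxy hσ φ hφ H m hm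
    exact le_trans (hxr dd hdd) hdx
  refine ⟨divMonomial n₀ C, ?_, ?_, ?_⟩
  · ext m
    rw [MvPowerSeries.coeff_monomial_mul]
    split_ifs with hle
    · rw [one_mul, coeff_divMonomial', tsub_add_cancel_of_le hle]
    · rw [finsupp_le_iff_two'' hσ, hn₀, single_add_single_apply_left'' hxy,
        single_add_single_apply_right'' hxy] at hle
      by_cases hmx : r ≤ m x
      · have hmy : m y < i := by omega
        have h1 := hzero (m y) hmy
        have h2 : MvPowerSeries.coeff m C = PowerSeries.coeff (m x - r) (R (m y)) := by
          rw [hR, show r + (m x - r) = m x by omega, ← eq_single_add_single' hxy hσ m]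
        rw [h2, h1, map_zero]
      · by_contra hne
        exact hmx (hxrC m hne)
  · rw [← MvPowerSeries.coeff_zero_eq_constantCoeff_apply, coeff_divMonomial', zero_add]
    exact hkey
  · have h1 := (coeff_cleanSeries_of_ne_zero (p ^ e) _ n₀ hkey).2
    rwa [forall_dvd_iff_two' hσ, hn₀, single_add_single_apply_left'' hxy, single_add_single_apply_right'' hxy] at h1

/-- **[HP24, Proposition 3] — the `s`-component, series level.**  For `H ∈ K[[x,y]]` with `x^r ∣ H`, all monomials of
degree `≥ r + d`, a clean one of degree `r + d`, and `d ≥ pᵉ`: EITHER some cleaned shifted expansion is a hidden monomial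
`x^r·y^d·u` (the terminal exit), OR the numerals `s⟨φ⟩` over all shifts `φ` (`φ(0) = 0`) have a GREATEST element, which
is FINITE — "There exists a maximizing flag … with `inv ∈ ℕ³`" for the case-(i) flags `F₁ = V(z₁, y + h(x))`.
[cite: HauserPerlega2024, Prop. 3 p. 791 l. 45 – p. 792 l. 44] -/
theorem exists_isGreatest_inf_rows_or_monomial (p : ℕ) [Fact p.Prime] [CharP K p] {e : ℕ} (x y : σ) (hxy : x ≠ y)
    (hσ : ∀ l, l = x ∨ l = y) (H : MvPowerSeries σ K) (r d : ℕ) (hq : p ^ e ≤ d)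
    (hxr : ∀ m, MvPowerSeries.coeff m H ≠ 0 → r ≤ m x)
    (hminH : ∀ m, MvPowerSeries.coeff m H ≠ 0 → r + d ≤ m x + m y)
    (hexH : ∃ m, MvPowerSeries.coeff m (cleanSeries (p ^ e) H) ≠ 0 ∧ m x + m y = r + d)
    (R : PowerSeries K → ℕ → PowerSeries K)
    (hR : ∀ φ j v, PowerSeries.coeff v (R φ j) = MvPowerSeries.coeff (Finsupp.single x (r + v) + Finsupp.single y j)
      (cleanSeries (p ^ e) (MvPowerSeries.subst (fun l => if l = y then
        (MvPowerSeries.X y : MvPowerSeries σ K) + PowerSeries.subst (MvPowerSeries.X x : MvPowerSeries σ K) φ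
        else MvPowerSeries.X l) H))) :
    (∃ φ : PowerSeries K, PowerSeries.constantCoeff φ = 0 ∧ ∃ u : MvPowerSeries σ K,
      cleanSeries (p ^ e) (MvPowerSeries.subst (fun l => if l = y then
        (MvPowerSeries.X y : MvPowerSeries σ K) + PowerSeries.subst (MvPowerSeries.X x : MvPowerSeries σ K) φ
        else MvPowerSeries.X l) H) =
          MvPowerSeries.monomial (Finsupp.single x r + Finsupp.single y d) (1 : K) * u ∧
        MvPowerSeries.constantCoeff u ≠ 0 ∧ ¬ (p ^ e ∣ r ∧ p ^ e ∣ d)) ∨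
    (∃ φ : PowerSeries K, PowerSeries.constantCoeff φ = 0 ∧
      (Finset.range d).inf (fun i => ((d.factorial / (d - i) : ℕ) : ℕ∞) * (R φ i).order) < ⊤ ∧
      ∀ φ' : PowerSeries K, PowerSeries.constantCoeff φ' = 0 →
        (Finset.range d).inf (fun i => ((d.factorial / (d - i) : ℕ) : ℕ∞) * (R φ' i).order) ≤
          (Finset.range d).inf (fun i => ((d.factorial / (d - i) : ℕ) : ℕ∞) * (R φ i).order)) := by
  classical
  set s : PowerSeries K → ℕ∞ := fun φ =>
    (Finset.range d).inf (fun i => ((d.factorial / (d - i) : ℕ) : ℕ∞) * (R φ i).order) with hsdef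
  by_cases htop : ∃ φ : PowerSeries K, PowerSeries.constantCoeff φ = 0 ∧ s φ = ⊤
  · obtain ⟨φ, hφ, hφtop⟩ := htop
    exact Or.inl ⟨φ, hφ, exists_eq_monomial_mul_of_inf_rows_eq_top p x y hxy hσ H r d hxr hminH hexH φ hφ (R φ)
      (hR φ) hφtop⟩
  push Not at htop
  rcases exists_inf_rows_eq_top_or_bounded p x y hxy hσ H r d hq hxr hminH hexH R hR with ⟨φ, hφ, hφtop⟩ | ⟨B, hB⟩
  · exact absurd hφtop (htop φ hφ)
  · right
    set T : Set ℕ := {n | ∃ φ : PowerSeries K, PowerSeries.constantCoeff φ = 0 ∧ s φ = n} with hT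
    have h00 : PowerSeries.constantCoeff (0 : PowerSeries K) = 0 := map_zero _
    have hT0 : (s 0).toNat ∈ T := ⟨0, h00, (ENat.coe_toNat (htop 0 h00)).symm⟩
    have hbdd : BddAbove T := by
      refine ⟨B, fun n hn => ?_⟩
      obtain ⟨φ, hφ, hn⟩ := hn
      have h1 := hB φ hφ
      change s φ ≤ B at h1
      rw [hn] at h1
      exact_mod_cast h1
    obtain ⟨φ, hφ, hsφ⟩ := Nat.sSup_mem ⟨_, hT0⟩ hbdd
    refine ⟨φ, hφ, ?_, fun φ' hφ' => ?_⟩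
    · change s φ < ⊤
      rw [hsφ]
      exact WithTop.coe_lt_top _
    · change s φ' ≤ s φ
      have h1 : s φ' = ((s φ').toNat : ℕ∞) := (ENat.coe_toNat (htop φ' hφ')).symm
      rw [h1, hsφ]
      exact_mod_cast le_csSup hbdd ⟨φ', hφ', h1⟩

end SeriesCore

/-! ## D. The typed layer (`PointBlowupFlagInvariant`): Lemma 3 for a general pair of case-(i) flags, `s = ∞` is
terminal, and Proposition 3's `s`-component for `sValue` -/

section Typed

variable {σ : Type*} [Fintype σ] [DecidableEq σ] {K : Type*} [Field K]

omit [DecidableEq σ] in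
/-- two letters: a sum over all letters has two terms. [folklore] -/
private theorem sum_univ_two'' {M : Type*} [AddCommMonoid M] {x y : σ} (hxy : x ≠ y)
    (hσ : ∀ l, l = x ∨ l = y) (f : σ → M) : ∑ l, f l = f x + f y := by
  classical
  have huniv : (Finset.univ : Finset σ) = {x, y} := by
    ext l
    simp only [Finset.mem_univ, Finset.mem_insert, Finset.mem_singleton, true_iff]
    exact hσ l
  rw [huniv, Finset.sum_pair hxy]

/-- **The polynomial states satisfy the series-level hypotheses.**  Two letters, `E = ∅` or `{x}`, `F ≠ 0` clean:
the exceptional exponent is `x^r`, `x^r ∣ F`, every monomial of `F` has degree `≥ r + d_res` and a clean one has degree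
`r + d_res` (`d_res = ord F − r`). [cite: HauserPerlega2024, §4 p. 776 (d_res = ord G = ord F − ord_{E_a} F)] -/
theorem exists_excExponent_eq_single (p : ℕ) [Fact p.Prime] [CharP K p] (e : ℕ) (x y : σ) (hxy : x ≠ y)
    (hσ : ∀ l, l = x ∨ l = y) {E : Finset σ} (hE : E = ∅ ∨ E = {x}) {F : MvPolynomial σ K} (hF : F ≠ 0)
    (hclean : deletePthPowers (p ^ e) F = F) :
    ∃ r : ℕ, excExponent E F = Finsupp.single x r ∧
      (∀ m, MvPowerSeries.coeff m (F : MvPowerSeries σ K) ≠ 0 → r ≤ m x) ∧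
      (∀ m, MvPowerSeries.coeff m (F : MvPowerSeries σ K) ≠ 0 → r + dRes E F ≤ m x + m y) ∧
      (∃ m, MvPowerSeries.coeff m (cleanSeries (p ^ e) (F : MvPowerSeries σ K)) ≠ 0 ∧
        m x + m y = r + dRes E F) := by
  classical
  obtain ⟨r, hr, hxr, hdres⟩ : ∃ r : ℕ, excExponent E F = Finsupp.single x r ∧ (∀ d ∈ F.support, r ≤ d x) ∧
      dRes E F = (ordZero F).toNat - r := by
    rcases hE with rfl | rfl
    · refine ⟨0, ?_, fun _ _ => Nat.zero_le _, ?_⟩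
      · unfold excExponent; rw [Finset.sum_empty, Finsupp.single_zero]
      · rw [dRes_empty, Nat.sub_zero]
    · refine ⟨ordVar F x, ?_, fun d hd => ?_, ?_⟩
      · unfold excExponent; rw [Finset.sum_singleton]
      · unfold ordVar bigH; exact ENat.toNat_le_of_le_coe (Finset.inf_le hd)
      · unfold dRes; rw [Finset.sum_singleton]
  have hne : ordZero F ≠ ⊤ := by
    unfold ordZero
    rw [Ne, MvPowerSeries.order_eq_top_iff, MvPolynomial.coe_eq_zero_iff]
    exact hF
  obtain ⟨o, ho'⟩ := WithTop.ne_top_iff_exists.mp hne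
  have ho : ordZero F = o := ho'.symm
  obtain ⟨⟨m₀, hm₀, hdeg₀⟩, hmin₀⟩ := (ordZero_eq_nat_iff F o).mp ho
  rw [Finsupp.degree_eq_sum, sum_univ_two'' hxy hσ] at hdeg₀
  have hrm₀ : r ≤ m₀ x := hxr m₀ (MvPolynomial.mem_support_iff.mpr hm₀)
  have hd : dRes E F = o - r := by rw [hdres, ho]; rfl
  refine ⟨r, hr, fun m hm => ?_, fun m hm => ?_, ⟨m₀, ?_, by omega⟩⟩
  · rw [MvPolynomial.coeff_coe] at hm
    exact hxr m (MvPolynomial.mem_support_iff.mpr hm)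
  · rw [MvPolynomial.coeff_coe] at hm
    have h1 : ¬ m.degree < o := fun hlt => hm (hmin₀ m hlt)
    rw [Finsupp.degree_eq_sum, sum_univ_two'' hxy hσ] at h1
    omega
  · have hnp : ¬ IsPthPowerExponent (p ^ e) m₀ := by
      intro hP
      apply hm₀
      rw [← hclean, coeff_deletePthPowers, if_pos hP]
    rw [coeff_cleanSeries, ← isPthPowerExponent_iff, if_neg hnp, MvPolynomial.coeff_coe]
    exact hm₀

omit [Fintype σ] in
/-- **the rows of `residualFlat` are the rows of the cleaned shifted expansion of `↑F`** (relative to the exceptional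
exponent `x^r`; flag `⟨y, x, h⟩` = shift `y ↦ y − h(x)`). [cite: HauserPerlega2024, §5 p. 783 (F = M·G in parameters subordinate to 𝓕 and E_a)] -/
theorem coeff_row_residualFlat (q : ℕ) (x y : σ) (hxy : x ≠ y) (hσ : ∀ l, l = x ∨ l = y) (E : Finset σ)
    (F : MvPolynomial σ K) {r : ℕ} (hr : excExponent E F = Finsupp.single x r) (h : PowerSeries K) (j v : ℕ) :
    PowerSeries.coeff v (PowerSeries.mk fun a =>
        MvPowerSeries.coeff (Finsupp.single x a + Finsupp.single y j) (residualFlat q E ⟨y, x, h⟩ F)) =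
      MvPowerSeries.coeff (Finsupp.single x (r + v) + Finsupp.single y j)
        (cleanSeries q (MvPowerSeries.subst (fun l => if l = y then
        (MvPowerSeries.X y : MvPowerSeries σ K) + PowerSeries.subst (MvPowerSeries.X x : MvPowerSeries σ K) (-h)
        else MvPowerSeries.X l) (F : MvPowerSeries σ K))) := by
  have hres : residualFlat q E ⟨y, x, h⟩ F = divMonomial (excExponent E F) (cleanSeries q (substFree x y (-h) F)) :=
    rfl
  have hm : Finsupp.single x v + Finsupp.single y j + Finsupp.single x r =
      Finsupp.single x (r + v) + Finsupp.single y j := by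
    apply finsupp_eq_two'' hσ
    · rw [Finsupp.add_apply, single_add_single_apply_left'' hxy, single_add_single_apply_left'' hxy,
        Finsupp.single_eq_same, add_comm]
    · rw [Finsupp.add_apply, single_add_single_apply_right'' hxy, single_add_single_apply_right'' hxy,
        Finsupp.single_apply, if_neg hxy, add_zero]
  rw [PowerSeries.coeff_mk, hres, hr, coeff_divMonomial', hm, substFree_eq_subst]

omit [Fintype σ] in
/-- a hidden monomial along a case-(i) flag makes the state terminal (`IsTerminalSub`). [cite: HauserPerlega2024, §3 p. 775 (monomial case) and Prop. 3 proof p. 792 l. 38–40] -/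
private theorem isTerminalSub_of_eq_monomial_mul (q : ℕ) (x y : σ) (hxy : x ≠ y) (hσ : ∀ l, l = x ∨ l = y)
    {E : Finset σ} (hE : E = ∅ ∨ E = {x}) (F : MvPolynomial σ K) {r : ℕ} (hr : excExponent E F = Finsupp.single x r)
    (d : ℕ) (φ : PowerSeries K) (hφ : PowerSeries.constantCoeff φ = 0) (u : MvPowerSeries σ K)
    (hfac : cleanSeries q (MvPowerSeries.subst (fun l => if l = y then
        (MvPowerSeries.X y : MvPowerSeries σ K) + PowerSeries.subst (MvPowerSeries.X x : MvPowerSeries σ K) φ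
        else MvPowerSeries.X l) (F : MvPowerSeries σ K)) =
      MvPowerSeries.monomial (Finsupp.single x r + Finsupp.single y d) (1 : K) * u)
    (hu : MvPowerSeries.constantCoeff u ≠ 0) (hndvd : ¬ (q ∣ r ∧ q ∣ d)) : IsTerminalSub q E F := by
  classical
  have hyE : y ∉ E := by
    rcases hE with rfl | rfl
    · exact Finset.notMem_empty y
    · rw [Finset.mem_singleton]; exact Ne.symm hxy
  refine ⟨⟨y, x, -φ⟩, ⟨⟨Ne.symm hxy, by rw [map_neg, hφ, neg_zero]⟩, fun h => absurd h hyE⟩,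
    Or.inl ⟨Finsupp.single x r + Finsupp.single y d, u, ?_, hu, ?_, ?_⟩⟩
  · show cleanSeries q (substFree x y (-(-φ)) F) = _
    rw [neg_neg, substFree_eq_subst]
    exact hfac
  · rw [forall_dvd_iff_two' hσ, single_add_single_apply_left'' hxy, single_add_single_apply_right'' hxy]
    exact hndvd
  · intro hE0
    rw [hE0] at hr
    unfold excExponent at hr
    rw [Finset.sum_empty] at hr
    have hr0 : r = 0 := by
      have h1 := DFunLike.congr_fun hr x
      rw [Finsupp.single_eq_same] at h1
      exact h1.symm
    exact ⟨x, by rw [single_add_single_apply_left'' hxy, hr0]⟩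

/-- **[HP24, Lemma 3] for a general pair of case-(i) flags** `𝓕 = ⟨y,x,h₁⟩` (`F₁ = V(z₁, y + h₁(x))`) and
`𝓖 = ⟨y,x,h₂⟩`: if `s_𝓖 > s_𝓕` then `d_res!·ord(h₂ − h₁) = s_𝓕` — the printed lemma after the re-basing `y₁ := y + h₁`
left open in `PointBlowupFlagShiftBound` (two letters; `E = ∅ ∨ E = {x}`; `F ≠ 0` clean; `d_res ≥ pᵉ`).
[cite: HauserPerlega2024, Lemma 3 p. 791 l. 2–5; Prop. 3 proof p. 792 l. 20–24 ("ord(h_{i+1} − h_i) = s_{𝓕^i}/d!")] -/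
theorem factorial_mul_order_sub_eq_sValue_of_lt (p : ℕ) [Fact p.Prime] [CharP K p] {e : ℕ} (x y : σ)
    (hxy : x ≠ y) (hσ : ∀ l, l = x ∨ l = y) {E : Finset σ} (hE : E = ∅ ∨ E = {x}) {F : MvPolynomial σ K}
    (hF : F ≠ 0) (hclean : deletePthPowers (p ^ e) F = F) (hq : p ^ e ≤ dRes E F) (h₁ h₂ : PowerSeries K)
    (hh₁ : PowerSeries.constantCoeff h₁ = 0) (hh₂ : PowerSeries.constantCoeff h₂ = 0)
    (hlt : sValue (p ^ e) E ⟨y, x, h₁⟩ F < sValue (p ^ e) E ⟨y, x, h₂⟩ F) :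
    ((dRes E F).factorial : ℕ∞) * (h₂ - h₁).order = sValue (p ^ e) E ⟨y, x, h₁⟩ F := by
  classical
  obtain ⟨r, hr, hxrH, hminH, hexH⟩ := exists_excExponent_eq_single p e x y hxy hσ hE hF hclean
  set d := dRes E F with hddef
  set R : PowerSeries K → ℕ → PowerSeries K := fun φ j => PowerSeries.mk fun a =>
    MvPowerSeries.coeff (Finsupp.single x a + Finsupp.single y j) (residualFlat (p ^ e) E ⟨y, x, -φ⟩ F) with hRdef
  have hR : ∀ φ j v, PowerSeries.coeff v (R φ j) =
      MvPowerSeries.coeff (Finsupp.single x (r + v) + Finsupp.single y j)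
        (cleanSeries (p ^ e) (MvPowerSeries.subst (fun l => if l = y then
        (MvPowerSeries.X y : MvPowerSeries σ K) + PowerSeries.subst (MvPowerSeries.X x : MvPowerSeries σ K) φ
        else MvPowerSeries.X l) (F : MvPowerSeries σ K))) := by
    intro φ j v
    rw [hRdef]
    dsimp only
    rw [coeff_row_residualFlat (p ^ e) x y hxy hσ E F hr (-φ) j v, neg_neg]
  have hs : ∀ h : PowerSeries K, sValue (p ^ e) E ⟨y, x, h⟩ F =
      (Finset.range d).inf (fun i => ((d.factorial / (d - i) : ℕ) : ℕ∞) * (R (-h) i).order) := by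
    intro h
    rw [sValue_eq_inf_of_le (p ^ e) E ⟨y, x, h⟩ F hq, hRdef, ← hddef]
    simp only [neg_neg]
  rw [hs h₁, hs h₂] at hlt
  rw [hs h₁, ← PowerSeries.order_neg, neg_sub, show h₁ - h₂ = -h₂ - -h₁ by ring]
  exact factorial_mul_order_sub_eq_inf_rows_of_lt p x y hxy hσ _ r d hq hxrH hminH hexH (-h₁) (-h₂)
    (by rw [map_neg, hh₁, neg_zero]) (by rw [map_neg, hh₂, neg_zero]) (R (-h₁)) (R (-h₂)) (hR (-h₁)) (hR (-h₂)) hlt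

/-- **`s_𝓕 = ∞` is a terminal case**: a case-(i) flag `⟨y,x,h⟩` with `sValue = ⊤` exhibits the (hidden) MONOMIAL CASE in
the subordinate parameters — "`G₁ = y₁^{d_res}·u` for some unit `u` … `X` is in the monomial case at `a`" — so the
state is `IsTerminalSub`. [cite: HauserPerlega2024, Prop. 3 proof p. 792 l. 31–40] -/
theorem isTerminalSub_of_sValue_eq_top (p : ℕ) [Fact p.Prime] [CharP K p] {e : ℕ} (x y : σ) (hxy : x ≠ y)
    (hσ : ∀ l, l = x ∨ l = y) {E : Finset σ} (hE : E = ∅ ∨ E = {x}) {F : MvPolynomial σ K} (hF : F ≠ 0)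
    (hclean : deletePthPowers (p ^ e) F = F) (hq : p ^ e ≤ dRes E F) (h : PowerSeries K)
    (hh : PowerSeries.constantCoeff h = 0) (htop : sValue (p ^ e) E ⟨y, x, h⟩ F = ⊤) :
    IsTerminalSub (p ^ e) E F := by
  classical
  obtain ⟨r, hr, hxrH, hminH, hexH⟩ := exists_excExponent_eq_single p e x y hxy hσ hE hF hclean
  set d := dRes E F with hddef
  set Rh : ℕ → PowerSeries K := fun j => PowerSeries.mk fun a =>
    MvPowerSeries.coeff (Finsupp.single x a + Finsupp.single y j) (residualFlat (p ^ e) E ⟨y, x, h⟩ F) with hRdef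
  have hnegh : PowerSeries.constantCoeff (-h) = 0 := by rw [map_neg, hh, neg_zero]
  have hRh : ∀ j v, PowerSeries.coeff v (Rh j) =
      MvPowerSeries.coeff (Finsupp.single x (r + v) + Finsupp.single y j)
        (cleanSeries (p ^ e) (MvPowerSeries.subst (fun l => if l = y then
        (MvPowerSeries.X y : MvPowerSeries σ K) + PowerSeries.subst (MvPowerSeries.X x : MvPowerSeries σ K) (-h)
        else MvPowerSeries.X l) (F : MvPowerSeries σ K))) := by
    intro j v
    rw [hRdef]
    exact coeff_row_residualFlat (p ^ e) x y hxy hσ E F hr h j v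
  have htop' : (Finset.range d).inf (fun i => ((d.factorial / (d - i) : ℕ) : ℕ∞) * (Rh i).order) = ⊤ := by
    rw [sValue_eq_inf_of_le (p ^ e) E ⟨y, x, h⟩ F hq, ← hddef] at htop
    rw [hRdef]
    exact htop
  obtain ⟨u, hfac, hu, hndvd⟩ := exists_eq_monomial_mul_of_inf_rows_eq_top p x y hxy hσ _ r d hxrH hminH hexH
    (-h) hnegh Rh hRh htop'
  exact isTerminalSub_of_eq_monomial_mul (p ^ e) x y hxy hσ hE F hr d (-h) hnegh u hfac hu hndvd

/-- **[HP24, Proposition 3] — the `s`-component, typed.**  Two letters, `E = ∅` or `{x}`, `F ≠ 0` clean,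
`d_res ≥ pᵉ`, NOT a terminal case: among the case-(i) flags `⟨y, x, h⟩` (`F₁ = V(z₁, y + h(x))`, `h(0) = 0`) there is one
whose numeral `s_𝓕` is GREATEST, and it is FINITE — "There exists a maximizing flag … with `inv^𝓕_a(X) ∈ ℕ³`" for the
flags with `n_𝓕 = 0` (whose first two components `(d_res, 0)` are common). [cite: HauserPerlega2024, Prop. 3 p. 791 l. 45 – p. 792 l. 44] -/
theorem exists_isGreatest_sValue (p : ℕ) [Fact p.Prime] [CharP K p] {e : ℕ} (x y : σ) (hxy : x ≠ y)
    (hσ : ∀ l, l = x ∨ l = y) {E : Finset σ} (hE : E = ∅ ∨ E = {x}) {F : MvPolynomial σ K} (hF : F ≠ 0)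
    (hclean : deletePthPowers (p ^ e) F = F) (hq : p ^ e ≤ dRes E F) (hnt : ¬ IsTerminalSub (p ^ e) E F) :
    ∃ h : PowerSeries K, PowerSeries.constantCoeff h = 0 ∧ sValue (p ^ e) E ⟨y, x, h⟩ F < ⊤ ∧
      ∀ h' : PowerSeries K, PowerSeries.constantCoeff h' = 0 →
        sValue (p ^ e) E ⟨y, x, h'⟩ F ≤ sValue (p ^ e) E ⟨y, x, h⟩ F := by
  classical
  obtain ⟨r, hr, hxrH, hminH, hexH⟩ := exists_excExponent_eq_single p e x y hxy hσ hE hF hclean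
  set d := dRes E F with hddef
  set R : PowerSeries K → ℕ → PowerSeries K := fun φ j => PowerSeries.mk fun a =>
    MvPowerSeries.coeff (Finsupp.single x a + Finsupp.single y j) (residualFlat (p ^ e) E ⟨y, x, -φ⟩ F) with hRdef
  have hR : ∀ φ j v, PowerSeries.coeff v (R φ j) =
      MvPowerSeries.coeff (Finsupp.single x (r + v) + Finsupp.single y j)
        (cleanSeries (p ^ e) (MvPowerSeries.subst (fun l => if l = y then
        (MvPowerSeries.X y : MvPowerSeries σ K) + PowerSeries.subst (MvPowerSeries.X x : MvPowerSeries σ K) φ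
        else MvPowerSeries.X l) (F : MvPowerSeries σ K))) := by
    intro φ j v
    rw [hRdef]
    dsimp only
    rw [coeff_row_residualFlat (p ^ e) x y hxy hσ E F hr (-φ) j v, neg_neg]
  have hs : ∀ h : PowerSeries K, sValue (p ^ e) E ⟨y, x, h⟩ F =
      (Finset.range d).inf (fun i => ((d.factorial / (d - i) : ℕ) : ℕ∞) * (R (-h) i).order) := by
    intro h
    rw [sValue_eq_inf_of_le (p ^ e) E ⟨y, x, h⟩ F hq, hRdef, ← hddef]
    simp only [neg_neg]
  rcases exists_isGreatest_inf_rows_or_monomial p x y hxy hσ _ r d hq hxrH hminH hexH R hR with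
    ⟨φ, hφ, u, hfac, hu, hndvd⟩ | ⟨φ, hφ, hlt, hmax⟩
  · exact absurd (isTerminalSub_of_eq_monomial_mul (p ^ e) x y hxy hσ hE F hr d φ hφ u hfac hu hndvd) hnt
  · refine ⟨-φ, by rw [map_neg, hφ, neg_zero], ?_, fun h' hh' => ?_⟩
    · rw [hs (-φ), neg_neg]; exact hlt
    · rw [hs h', hs (-φ), neg_neg]
      exact hmax (-h') (by rw [map_neg, hh', neg_zero])

end Typed

end HauserPerlega2024

end Literature.AlgebraicGeometry.Resolution
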